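import Summits.QuantumFields.YangMills.Theorems.BalabanUVNodesN15KingModelPauliLinksGap
import HarnessLib

/-!
# BalabanUVNodes ∕ N15 — THE KING-MODEL RUNG (PART Ϸ-i): THREE NON-COMMUTING CONSTANT LINKS — `W_{ν₀} = e^{iaσ₁}`, `W_{ν₁} = e^{ibσ₂}`, `W_{ν₂} = e^{icσ₃}` on three distinct directions:
# the FULL BLOCH SPHERE `⟨σ₁⟩² + ⟨σ₂⟩² + ⟨σ₃⟩² = ‖ξ‖⁴` and the three-direction sum-of-squares lemma give `Re⟨v,(−cΔ_W+m²)v⟩ ≥ (m² + c·(sin²a + sin²b + sin²c − max))·Σ‖v_x‖²` —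
# the mass is the sum of the TWO SMALLEST `sin²`: every further non-commuting direction ADDS mass (Track A, DAG node N15 = NE2; FAN-OUT v1.1 §N15 s3 «KING-MODEL RUNG»; count-neutral)

HONEST FRAMING.  Count-neutral (cell `pub-ymgap`, seat `pub-ymgap-dag-n15-e` g48; `--supports stmt-QuantumFields-27247 --as helper` = K3ᴬ, KEY MAP v3).  King's fine covariance layer
`−cΔ_U + m²` (Ͱ-a `covLapF`) at a constant `SU(2)` link TRIPLE on one finite torus per spacing (`d + 1 ≥ 3` directions needed for three distinct `ν`'s); elementary real algebra per
momentum fibre (PART Ϸ-a's symbol); NOT Bałaban's `G_k(U)`; NOT a node discharge (N15 of record untouched); nothing continuum ∕ ℝ⁴ ∕ OS ∕ Clay.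

THE RESULTS (`K` any period vector; `ν₀, ν₁, ν₂` pairwise distinct; `W = pauliTriple a b c ν₀ ν₁ ν₂`; `S = sin²a + sin²b + sin²c`, `M = max(sin²a, sin²b, sin²c)`):
* §1 `rotZ c = diag(e^{ic}, e^{−ic}) = cos c·1 + i sin c·σ₃`, unitarity, `norm_sq_sub_smul_rotZ` (Ϸ-c `norm_sq_sub_smul_rot` at `σ₃`), ★ `re_inner_pauliZ` (`⟨σ₃⟩_ξ = |ξ₀|² − |ξ₁|²`),
  ★★ **`bloch_sphere`** (`⟨σ₁⟩_ξ² + ⟨σ₂⟩_ξ² + ⟨σ₃⟩_ξ² = ‖ξ‖⁴` EXACTLY: the pure-state Bloch vector has length `‖ξ‖²`);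
* §2 ★★★ **`pauli_fibre_bound₃`** (three dressed directions, `r₀² + r₁² + r₂² ≤ N²`: `(β₀² + β₁² + β₂² − max)·N ≤ Σ_μ[2(1 − x_μα_μ)N + 2y_μβ_μr_μ]`), `pauliTriple`, its values and unitarity,
  ★★ **`pauli_fibre_coercive₃`** (every momentum: `(m² + c(S − M))‖ξ‖² ≤ m²‖ξ‖² + cΣ_μ‖ξ − ψ_μ(q)W_μξ‖²`);
* §3 ★★★ **`re_quadForm_covLapF_pauliTriple_ge`** (`(m² + c(S − M))·Σ_x‖v_x‖² ≤ Re⟨v,(−cΔ_W+m²)v⟩` on EVERY torus), ★★ `eigenvalues_covLapF_pauliTriple_ge`, ★★ `posDef_covLapF_pauliTriple`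
  (`m² + c(S − M) > 0`), ★★ `l2_opNorm_covLapF_pauliTriple_inv_le`; `sum_sub_max_ge_min_pair` (`S − M ≥ min(sin²a, sin²b)`: the third link never LOWERS PART Ϸ-d's floor) and
  ★★ **`re_quadForm_covLapF_pauliTriple_ge_pair`** (the pair's floor survives the third link).
PRIOR TREE ART (by name): Ϸ-a (`kingConstLink`, `coercive_covLapF_kingConstLink_of_fibre` + corollaries), Ϸ-c (`pauliX∕Y∕Z`, `rotX`, `rotY`, `isHermitian_pauliZ`, `pauliZ_mul_self`, `norm_sq_sub_smul_rot`,
`norm_sq_sub_smul_rotX∕Y`, `re_inner_pauliX∕Y`, `norm_sq_fin_two`, `cos_sq_add_sin_sq_complex`), Ϸ-d (`dressed_direction_ge`, `re_sq_add_im_sq_chi_unitVec`), `TorusSpectral.norm_chi_eq_one`.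
Dedup (rg at filing): basename 0 files; needles `rotZ|pauliTriple|bloch_sphere|pauli_fibre_bound₃|re_inner_pauliZ` 0 tree files.  Locators: [King1986] (2.12) p.653, (4.4) p.670, (4.35) p.674;
[Balaban1985BackgroundPropagators] (3.3) p.391, (3.23) p.394, (3.39) p.397.  0 `sorry`, 2 `def`.
-/

noncomputable section

open scoped BigOperators ComplexConjugate ComplexOrder InnerProductSpace
open Finset Matrix WithLp

namespace Summit.QuantumFields.YangMills.BalabanUVNodes.N15KingModelRung.ConstantCurvature

open Literature.MathematicalPhysics.QuantumFieldTheory.Balaban1983to89.B5Prop11Plancherel (Tor unitVec chi)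
open Summit.QuantumFields.YangMills.BalabanUVNodes.N15KingModelRung.Covariant (covLapF fib isHermitian_covLapF)
open Summit.QuantumFields.YangMills.BalabanUVNodes.N15KingModelRung.TorusSpectral (norm_chi_eq_one)

/-! ## §1 The third one-parameter group and the full Bloch sphere -/

section Third

/-- `e^{icσ₃} = diag(e^{ic}, e^{−ic})`. [folklore] -/
def rotZ (c : ℝ) : Matrix (Fin 2) (Fin 2) ℂ := !![(Real.cos c : ℂ) + Real.sin c * Complex.I, 0; 0, (Real.cos c : ℂ) - Real.sin c * Complex.I]

/-- `e^{icσ₃} = cos c·1 + (i sin c)·σ₃`. [folklore] -/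
theorem rotZ_eq (c : ℝ) : rotZ c = (Real.cos c : ℂ) • (1 : Matrix (Fin 2) (Fin 2) ℂ) + ((Real.sin c : ℂ) * Complex.I) • pauliZ := by
  ext i j; fin_cases i <;> fin_cases j <;> simp [rotZ, pauliZ]
  ring

/-- ★ `e^{icσ₃} ∈ U(2)`. [folklore] -/
theorem rotZ_mem_unitaryGroup (c : ℝ) : rotZ c ∈ Matrix.unitaryGroup (Fin 2) ℂ := by
  rw [Matrix.mem_unitaryGroup_iff, Matrix.star_eq_conjTranspose]
  have h := cos_sq_add_sin_sq_complex c
  ext i j; fin_cases i <;> fin_cases j <;>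
    simp [rotZ, Matrix.mul_apply, Fin.sum_univ_two, Matrix.conjTranspose_apply, Complex.conj_ofReal, -Complex.ofReal_cos, -Complex.ofReal_sin] <;> ring_nf <;>
    simp only [Complex.I_sq] <;> linear_combination h

/-- `‖ξ − ψ·e^{icσ₃}ξ‖² = 2(1 − Re ψ cos c)‖ξ‖² + 2 Im ψ sin c·Re⟪ξ,σ₃ξ⟫`. [cite: Balaban1985BackgroundPropagators, (3.3) p.391] -/
theorem norm_sq_sub_smul_rotZ (c : ℝ) {ψ : ℂ} (hψ : ‖ψ‖ = 1) (ξ : EuclideanSpace ℂ (Fin 2)) :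
    ‖ξ - ψ • Matrix.toEuclideanLin (rotZ c) ξ‖ ^ 2
      = 2 * (1 - ψ.re * Real.cos c) * ‖ξ‖ ^ 2 + 2 * ψ.im * Real.sin c * RCLike.re ⟪ξ, Matrix.toEuclideanLin pauliZ ξ⟫_ℂ :=
  norm_sq_sub_smul_rot isHermitian_pauliZ (rotZ_eq c) (rotZ_mem_unitaryGroup c) hψ ξ

/-- ★ THE BLOCH COMPONENT `⟨σ₃⟩_ξ = |ξ₀|² − |ξ₁|²`. [folklore] -/
theorem re_inner_pauliZ (ξ : EuclideanSpace ℂ (Fin 2)) : RCLike.re ⟪ξ, Matrix.toEuclideanLin pauliZ ξ⟫_ℂ = ‖ξ 0‖ ^ 2 - ‖ξ 1‖ ^ 2 := by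
  rw [EuclideanSpace.inner_eq_star_dotProduct, Matrix.ofLp_toLpLin, Matrix.toLin'_apply]
  simp only [dotProduct, Matrix.mulVec, Fin.sum_univ_two, pauliZ, Pi.star_apply, RCLike.star_def, Matrix.of_apply, Matrix.cons_val', Matrix.cons_val_zero,
    Matrix.cons_val_one, Matrix.empty_val', Matrix.cons_val_fin_one, RCLike.re_to_complex]
  show ((1 * ξ.ofLp 0 + 0 * ξ.ofLp 1) * conj (ξ.ofLp 0) + (0 * ξ.ofLp 0 + -1 * ξ.ofLp 1) * conj (ξ.ofLp 1)).re = ‖ξ.ofLp 0‖ ^ 2 - ‖ξ.ofLp 1‖ ^ 2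
  rw [Complex.sq_norm, Complex.sq_norm, Complex.normSq_apply, Complex.normSq_apply]
  simp only [Complex.add_re, Complex.mul_re, Complex.mul_im, Complex.add_im, Complex.neg_re, Complex.neg_im, Complex.conj_re, Complex.conj_im, Complex.one_re, Complex.one_im,
    Complex.zero_re, Complex.zero_im]
  ring

/-- ★★ **THE BLOCH SPHERE**: `⟨σ₁⟩_ξ² + ⟨σ₂⟩_ξ² + ⟨σ₃⟩_ξ² = ‖ξ‖⁴` exactly (`(2Re ξ̄₀ξ₁)² + (2Im ξ̄₀ξ₁)² + (|ξ₀|²−|ξ₁|²)² = (|ξ₀|²+|ξ₁|²)²`). [folklore] -/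
theorem bloch_sphere (ξ : EuclideanSpace ℂ (Fin 2)) :
    (RCLike.re ⟪ξ, Matrix.toEuclideanLin pauliX ξ⟫_ℂ) ^ 2 + (RCLike.re ⟪ξ, Matrix.toEuclideanLin pauliY ξ⟫_ℂ) ^ 2 + (RCLike.re ⟪ξ, Matrix.toEuclideanLin pauliZ ξ⟫_ℂ) ^ 2
      = (‖ξ‖ ^ 2) ^ 2 := by
  rw [re_inner_pauliX, re_inner_pauliY, re_inner_pauliZ, norm_sq_fin_two]
  set w : ℂ := conj (ξ 0) * ξ 1 with hw
  have hw2 : ‖w‖ ^ 2 = ‖ξ 0‖ ^ 2 * ‖ξ 1‖ ^ 2 := by rw [hw, norm_mul, Complex.norm_conj, mul_pow]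
  have hri : w.re ^ 2 + w.im ^ 2 = ‖w‖ ^ 2 := by rw [Complex.sq_norm, Complex.normSq_apply]; ring
  nlinarith [hri, hw2]

end Third

/-! ## §2 The three-direction fibre lemma and the link triple -/

section Fibre
set_option maxHeartbeats 400000 in
/-- ★★★ **THE THREE-DIRECTION FIBRE LEMMA**: phases `x_μ + iy_μ` on the unit circle, link angles `(α_μ, β_μ)`, `N ≥ 0`, Bloch components with `r₀² + r₁² + r₂² ≤ N²`:
`(β₀² + β₁² + β₂² − max(β₀²,β₁²,β₂²))·N ≤ Σ_μ[2(1 − x_μα_μ)N + 2y_μβ_μr_μ]` — the two smallest dressed directions survive. [folklore] -/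
theorem pauli_fibre_bound₃ {x₀ y₀ x₁ y₁ x₂ y₂ α₀ β₀ α₁ β₁ α₂ β₂ N r₀ r₁ r₂ : ℝ}
    (h0 : x₀ ^ 2 + y₀ ^ 2 = 1) (h1 : x₁ ^ 2 + y₁ ^ 2 = 1) (h2 : x₂ ^ 2 + y₂ ^ 2 = 1)
    (hα0 : α₀ ^ 2 + β₀ ^ 2 = 1) (hα1 : α₁ ^ 2 + β₁ ^ 2 = 1) (hα2 : α₂ ^ 2 + β₂ ^ 2 = 1) (hN : 0 ≤ N) (hr : r₀ ^ 2 + r₁ ^ 2 + r₂ ^ 2 ≤ N ^ 2) :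
    (β₀ ^ 2 + β₁ ^ 2 + β₂ ^ 2 - max (β₀ ^ 2) (max (β₁ ^ 2) (β₂ ^ 2))) * N
      ≤ (2 * (1 - x₀ * α₀) * N + 2 * y₀ * β₀ * r₀) + (2 * (1 - x₁ * α₁) * N + 2 * y₁ * β₁ * r₁) + (2 * (1 - x₂ * α₂) * N + 2 * y₂ * β₂ * r₂) := by
  set M := max (β₀ ^ 2) (max (β₁ ^ 2) (β₂ ^ 2)) with hMdef
  have e0 := dressed_direction_ge x₀ y₀ α₀ β₀ N r₀ h0 hα0
  have e1 := dressed_direction_ge x₁ y₁ α₁ β₁ N r₁ h1 hα1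
  have e2 := dressed_direction_ge x₂ y₂ α₂ β₂ N r₂ h2 hα2
  have hM0 : β₀ ^ 2 ≤ M := le_max_left _ _
  have hM1 : β₁ ^ 2 ≤ M := (le_max_left _ _).trans (le_max_right _ _)
  have hM2 : β₂ ^ 2 ≤ M := (le_max_right _ _).trans (le_max_right _ _)
  have hMnn : 0 ≤ M := (sq_nonneg β₀).trans hM0
  rcases eq_or_lt_of_le hN with hN0 | hNpos
  · have hr0 : r₀ = 0 := by nlinarith [sq_nonneg r₀, sq_nonneg r₁, sq_nonneg r₂]
    have hr1 : r₁ = 0 := by nlinarith [sq_nonneg r₀, sq_nonneg r₁, sq_nonneg r₂]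
    have hr2 : r₂ = 0 := by nlinarith [sq_nonneg r₀, sq_nonneg r₁, sq_nonneg r₂]
    rw [← hN0, hr0, hr1, hr2]; simp
  · have key : (β₀ ^ 2 + β₁ ^ 2 + β₂ ^ 2 - M) * N * N
        ≤ ((2 * (1 - x₀ * α₀) * N + 2 * y₀ * β₀ * r₀) + (2 * (1 - x₁ * α₁) * N + 2 * y₁ * β₁ * r₁) + (2 * (1 - x₂ * α₂) * N + 2 * y₂ * β₂ * r₂)) * N := by
      nlinarith [mul_le_mul_of_nonneg_right hM0 (sq_nonneg r₀), mul_le_mul_of_nonneg_right hM1 (sq_nonneg r₁), mul_le_mul_of_nonneg_right hM2 (sq_nonneg r₂),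
        mul_le_mul_of_nonneg_left hr hMnn]
    exact le_of_mul_le_mul_right key hNpos

variable {d : ℕ} (K : Fin (d + 1) → ℕ)

/-- THE PAULI LINK TRIPLE (constant): `W_{ν₀} = e^{iaσ₁}`, `W_{ν₁} = e^{ibσ₂}`, `W_{ν₂} = e^{icσ₃}`, `W_μ = 1` otherwise. [cite: King1986, (2.12) p.653; Balaban1985BackgroundPropagators, (3.3) p.391] -/
def pauliTriple (a b c : ℝ) (ν₀ ν₁ ν₂ : Fin (d + 1)) : Fin (d + 1) → Matrix (Fin 2) (Fin 2) ℂ :=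
  fun μ => if μ = ν₀ then rotX a else if μ = ν₁ then rotY b else if μ = ν₂ then rotZ c else 1

/-- `W_{ν₀} = e^{iaσ₁}`. [folklore] -/
@[simp] theorem pauliTriple_fst (a b c : ℝ) (ν₀ ν₁ ν₂ : Fin (d + 1)) : pauliTriple (d := d) a b c ν₀ ν₁ ν₂ ν₀ = rotX a := by simp [pauliTriple]
/-- `W_{ν₁} = e^{ibσ₂}`. [folklore] -/
theorem pauliTriple_snd (a b c : ℝ) {ν₀ ν₁ ν₂ : Fin (d + 1)} (h01 : ν₀ ≠ ν₁) : pauliTriple (d := d) a b c ν₀ ν₁ ν₂ ν₁ = rotY b := by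
  simp [pauliTriple, Ne.symm h01]
/-- `W_{ν₂} = e^{icσ₃}`. [folklore] -/
theorem pauliTriple_thd (a b c : ℝ) {ν₀ ν₁ ν₂ : Fin (d + 1)} (h02 : ν₀ ≠ ν₂) (h12 : ν₁ ≠ ν₂) : pauliTriple (d := d) a b c ν₀ ν₁ ν₂ ν₂ = rotZ c := by
  simp [pauliTriple, Ne.symm h02, Ne.symm h12]
/-- The triple is a unitary link field. [folklore] -/
theorem pauliTriple_mem_unitaryGroup (a b c : ℝ) (ν₀ ν₁ ν₂ μ : Fin (d + 1)) : pauliTriple (d := d) a b c ν₀ ν₁ ν₂ μ ∈ Matrix.unitaryGroup (Fin 2) ℂ := by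
  unfold pauliTriple
  split_ifs
  · exact rotX_mem_unitaryGroup a
  · exact rotY_mem_unitaryGroup b
  · exact rotZ_mem_unitaryGroup c
  · exact Submonoid.one_mem _

variable [hK : ∀ μ, NeZero (K μ)]

/-- ★★ **THE TRIPLE's FIBRE IS COERCIVE, UNIFORMLY IN THE MOMENTUM**: `(m² + c·(S − M))‖ξ‖² ≤ m²‖ξ‖² + cΣ_μ‖ξ − ψ_μ(q)W_μξ‖²` with `S = sin²a+sin²b+sin²c`,
`M = max(sin²a, sin²b, sin²c)` (`c ≥ 0`; the flat directions dropped, the Bloch sphere for the three dressed ones). [cite: King1986, (4.4) p.670, (4.35) p.674; Balaban1985BackgroundPropagators, (3.23) p.394] -/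
theorem pauli_fibre_coercive₃ {cc : ℝ} (hc : 0 ≤ cc) (m2 a b c : ℝ) {ν₀ ν₁ ν₂ : Fin (d + 1)} (h01 : ν₀ ≠ ν₁) (h02 : ν₀ ≠ ν₂) (h12 : ν₁ ≠ ν₂) (q : Tor K)
    (ξ : EuclideanSpace ℂ (Fin 2)) :
    (m2 + cc * (Real.sin a ^ 2 + Real.sin b ^ 2 + Real.sin c ^ 2 - max (Real.sin a ^ 2) (max (Real.sin b ^ 2) (Real.sin c ^ 2)))) * ‖ξ‖ ^ 2
      ≤ m2 * ‖ξ‖ ^ 2 + cc * ∑ μ, ‖ξ - chi K q (unitVec K μ) • Matrix.toEuclideanLin (pauliTriple (d := d) a b c ν₀ ν₁ ν₂ μ) ξ‖ ^ 2 := by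
  set f : Fin (d + 1) → ℝ := fun μ => ‖ξ - chi K q (unitVec K μ) • Matrix.toEuclideanLin (pauliTriple (d := d) a b c ν₀ ν₁ ν₂ μ) ξ‖ ^ 2 with hf
  have hdrop : f ν₀ + f ν₁ + f ν₂ ≤ ∑ μ, f μ := by
    have hmem : ν₀ ∉ ({ν₁, ν₂} : Finset (Fin (d + 1))) := by simp [h01, h02]
    have h3 : ∑ μ ∈ ({ν₀, ν₁, ν₂} : Finset (Fin (d + 1))), f μ = f ν₀ + (f ν₁ + f ν₂) := by
      rw [Finset.sum_insert hmem, Finset.sum_pair h12]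
    rw [add_assoc, ← h3]
    exact Finset.sum_le_sum_of_subset_of_nonneg (Finset.subset_univ _) fun _ _ _ => sq_nonneg _
  have e0 : f ν₀ = 2 * (1 - (chi K q (unitVec K ν₀)).re * Real.cos a) * ‖ξ‖ ^ 2 + 2 * (chi K q (unitVec K ν₀)).im * Real.sin a * RCLike.re ⟪ξ, Matrix.toEuclideanLin pauliX ξ⟫_ℂ := by
    simp only [hf, pauliTriple_fst]; exact norm_sq_sub_smul_rotX a (norm_chi_eq_one K q (unitVec K ν₀)) ξ
  have e1 : f ν₁ = 2 * (1 - (chi K q (unitVec K ν₁)).re * Real.cos b) * ‖ξ‖ ^ 2 + 2 * (chi K q (unitVec K ν₁)).im * Real.sin b * RCLike.re ⟪ξ, Matrix.toEuclideanLin pauliY ξ⟫_ℂ := by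
    simp only [hf, pauliTriple_snd a b c h01]; exact norm_sq_sub_smul_rotY b (norm_chi_eq_one K q (unitVec K ν₁)) ξ
  have e2 : f ν₂ = 2 * (1 - (chi K q (unitVec K ν₂)).re * Real.cos c) * ‖ξ‖ ^ 2 + 2 * (chi K q (unitVec K ν₂)).im * Real.sin c * RCLike.re ⟪ξ, Matrix.toEuclideanLin pauliZ ξ⟫_ℂ := by
    simp only [hf, pauliTriple_thd a b c h02 h12]; exact norm_sq_sub_smul_rotZ c (norm_chi_eq_one K q (unitVec K ν₂)) ξ
  have hfib := pauli_fibre_bound₃ (re_sq_add_im_sq_chi_unitVec K q ν₀) (re_sq_add_im_sq_chi_unitVec K q ν₁) (re_sq_add_im_sq_chi_unitVec K q ν₂)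
    (Real.cos_sq_add_sin_sq a) (Real.cos_sq_add_sin_sq b) (Real.cos_sq_add_sin_sq c) (sq_nonneg ‖ξ‖) (bloch_sphere ξ).le
  rw [← e0, ← e1, ← e2] at hfib
  have hmin : (Real.sin a ^ 2 + Real.sin b ^ 2 + Real.sin c ^ 2 - max (Real.sin a ^ 2) (max (Real.sin b ^ 2) (Real.sin c ^ 2))) * ‖ξ‖ ^ 2 ≤ ∑ μ, f μ :=
    hfib.trans hdrop
  show _ ≤ m2 * ‖ξ‖ ^ 2 + cc * ∑ μ, f μ
  nlinarith [mul_le_mul_of_nonneg_left hmin hc]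

end Fibre

/-! ## §3 The gap of the triple on the torus -/

section Torus

variable {d : ℕ} (K : Fin (d + 1) → ℕ) [hK : ∀ μ, NeZero (K μ)]

/-- ★★★ **THE GAP OF THE LINK TRIPLE**: on EVERY torus, `(m² + c·(sin²a + sin²b + sin²c − max))·Σ_x‖v_x‖² ≤ Re⟨v,(−cΔ_W+m²)v⟩` (`c ≥ 0`; `ν₀,ν₁,ν₂` pairwise distinct) — the sum of the
two smallest `sin²`: each further non-commuting direction ADDS to the curvature mass. [cite: King1986, (4.4) p.670, (4.35) p.674; Balaban1985BackgroundPropagators, (3.23) p.394; DodziukMathai2006, Cor 1.3 §1] -/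
theorem re_quadForm_covLapF_pauliTriple_ge {cc : ℝ} (hc : 0 ≤ cc) (m2 a b c : ℝ) {ν₀ ν₁ ν₂ : Fin (d + 1)} (h01 : ν₀ ≠ ν₁) (h02 : ν₀ ≠ ν₂) (h12 : ν₁ ≠ ν₂)
    (v : Tor K × Fin 2 → ℂ) :
    (m2 + cc * (Real.sin a ^ 2 + Real.sin b ^ 2 + Real.sin c ^ 2 - max (Real.sin a ^ 2) (max (Real.sin b ^ 2) (Real.sin c ^ 2)))) * ∑ x, ‖fib K v x‖ ^ 2
      ≤ RCLike.re (star v ⬝ᵥ (covLapF K cc m2 (kingConstLink K (pauliTriple a b c ν₀ ν₁ ν₂)) *ᵥ v)) :=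
  coercive_covLapF_kingConstLink_of_fibre K (pauliTriple_mem_unitaryGroup a b c ν₀ ν₁ ν₂) cc m2 (fun q ξ => pauli_fibre_coercive₃ K hc m2 a b c h01 h02 h12 q ξ) v

/-- ★★ EVERY EIGENVALUE `≥ m² + c·(S − M)`. [cite: King1986, (4.4) p.670; Balaban1985BackgroundPropagators, (3.23) p.394] -/
theorem eigenvalues_covLapF_pauliTriple_ge {cc : ℝ} (hc : 0 ≤ cc) (m2 a b c : ℝ) {ν₀ ν₁ ν₂ : Fin (d + 1)} (h01 : ν₀ ≠ ν₁) (h02 : ν₀ ≠ ν₂) (h12 : ν₁ ≠ ν₂) (i : Tor K × Fin 2) :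
    m2 + cc * (Real.sin a ^ 2 + Real.sin b ^ 2 + Real.sin c ^ 2 - max (Real.sin a ^ 2) (max (Real.sin b ^ 2) (Real.sin c ^ 2)))
      ≤ (isHermitian_covLapF K cc m2 (kingConstLink K (pauliTriple a b c ν₀ ν₁ ν₂))).eigenvalues i :=
  eigenvalues_covLapF_kingConstLink_ge_of_fibre K (pauliTriple_mem_unitaryGroup a b c ν₀ ν₁ ν₂) cc m2 (fun q ξ => pauli_fibre_coercive₃ K hc m2 a b c h01 h02 h12 q ξ) i

/-- ★★ POSITIVE DEFINITE whenever `m² + c(S − M) > 0` — e.g. massless with at least TWO genuinely dressed directions. [cite: Balaban1985BackgroundPropagators, (3.23) p.394; DodziukMathai2006, Cor 1.3 §1] -/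
theorem posDef_covLapF_pauliTriple {cc : ℝ} (hc : 0 ≤ cc) {m2 a b c : ℝ}
    (hκ : 0 < m2 + cc * (Real.sin a ^ 2 + Real.sin b ^ 2 + Real.sin c ^ 2 - max (Real.sin a ^ 2) (max (Real.sin b ^ 2) (Real.sin c ^ 2))))
    {ν₀ ν₁ ν₂ : Fin (d + 1)} (h01 : ν₀ ≠ ν₁) (h02 : ν₀ ≠ ν₂) (h12 : ν₁ ≠ ν₂) :
    (covLapF K cc m2 (kingConstLink K (pauliTriple a b c ν₀ ν₁ ν₂))).PosDef :=
  posDef_covLapF_kingConstLink_of_fibre K (pauliTriple_mem_unitaryGroup a b c ν₀ ν₁ ν₂) cc m2 hκ (fun q ξ => pauli_fibre_coercive₃ K hc m2 a b c h01 h02 h12 q ξ)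

open scoped Matrix.Norms.L2Operator in
/-- ★★ `‖(−cΔ_W+m²)⁻¹‖_{ℓ²→ℓ²} ≤ (m² + c(S − M))⁻¹` on every torus. [cite: Balaban1985BackgroundPropagators, (3.39) p.397; King1986, (4.4) p.670] -/
theorem l2_opNorm_covLapF_pauliTriple_inv_le {cc : ℝ} (hc : 0 ≤ cc) {m2 a b c : ℝ}
    (hκ : 0 < m2 + cc * (Real.sin a ^ 2 + Real.sin b ^ 2 + Real.sin c ^ 2 - max (Real.sin a ^ 2) (max (Real.sin b ^ 2) (Real.sin c ^ 2))))
    {ν₀ ν₁ ν₂ : Fin (d + 1)} (h01 : ν₀ ≠ ν₁) (h02 : ν₀ ≠ ν₂) (h12 : ν₁ ≠ ν₂) :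
    ‖(covLapF K cc m2 (kingConstLink K (pauliTriple a b c ν₀ ν₁ ν₂)))⁻¹‖
      ≤ (m2 + cc * (Real.sin a ^ 2 + Real.sin b ^ 2 + Real.sin c ^ 2 - max (Real.sin a ^ 2) (max (Real.sin b ^ 2) (Real.sin c ^ 2))))⁻¹ :=
  l2_opNorm_covLapF_kingConstLink_inv_le_of_fibre K (pauliTriple_mem_unitaryGroup a b c ν₀ ν₁ ν₂) cc m2 hκ (fun q ξ => pauli_fibre_coercive₃ K hc m2 a b c h01 h02 h12 q ξ)

omit hK in
/-- `S − M ≥ min(sin²a, sin²b)`: a third link never LOWERS the pair's floor (the sum of the two smallest of three is at least the smaller of the first two). [folklore] -/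
theorem sum_sub_max_ge_min_pair (a b c : ℝ) :
    min (Real.sin a ^ 2) (Real.sin b ^ 2) ≤ Real.sin a ^ 2 + Real.sin b ^ 2 + Real.sin c ^ 2 - max (Real.sin a ^ 2) (max (Real.sin b ^ 2) (Real.sin c ^ 2)) := by
  set A := Real.sin a ^ 2; set B := Real.sin b ^ 2; set C := Real.sin c ^ 2
  have hA : 0 ≤ A := sq_nonneg _; have hC : 0 ≤ C := sq_nonneg _
  have hAB : 0 ≤ max A B := hA.trans (le_max_left A B)
  have h1 : max A (max B C) ≤ max A B + C :=
    max_le (by linarith [le_max_left A B]) (max_le (by linarith [le_max_right A B]) (by linarith))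
  have h2 : min A B + max A B = A + B := min_add_max A B
  linarith

/-- ★★ **THE PAIR's FLOOR SURVIVES THE THIRD LINK**: `(m² + c·min(sin²a, sin²b))·Σ‖v_x‖² ≤ Re⟨v,(−cΔ_W+m²)v⟩` for the triple too. [cite: King1986, (4.4) p.670; Balaban1985BackgroundPropagators, (3.23) p.394] -/
theorem re_quadForm_covLapF_pauliTriple_ge_pair {cc : ℝ} (hc : 0 ≤ cc) (m2 a b c : ℝ) {ν₀ ν₁ ν₂ : Fin (d + 1)} (h01 : ν₀ ≠ ν₁) (h02 : ν₀ ≠ ν₂) (h12 : ν₁ ≠ ν₂)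
    (v : Tor K × Fin 2 → ℂ) :
    (m2 + cc * min (Real.sin a ^ 2) (Real.sin b ^ 2)) * ∑ x, ‖fib K v x‖ ^ 2 ≤ RCLike.re (star v ⬝ᵥ (covLapF K cc m2 (kingConstLink K (pauliTriple a b c ν₀ ν₁ ν₂)) *ᵥ v)) := by
  refine le_trans ?_ (re_quadForm_covLapF_pauliTriple_ge K hc m2 a b c h01 h02 h12 v)
  exact mul_le_mul_of_nonneg_right (by nlinarith [mul_le_mul_of_nonneg_left (sum_sub_max_ge_min_pair a b c) hc]) (Finset.sum_nonneg fun _ _ => sq_nonneg _)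

end Torus

end Summit.QuantumFields.YangMills.BalabanUVNodes.N15KingModelRung.ConstantCurvature

end
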